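import Literature.Computability.Cryptography.RegevSamplerClassical
import HarnessLib

/-!
# Regev 2009, Lemma 3.14 in machine form: the classical stage with a placed subroutine, as one circuit

Topic `Computability/Cryptography` (family `pqc`), grouping namespace `Regev2009.SamplerClassical`; sequel of
`RegevSamplerClassical.lean` (`stageMat hΛ hF O = O · C_X · O · C_S · C_Y`: the MATRIX of the sampler's
classical stage with an oracle slot `O`, the three compiled blocks `circY`, `circS`, `circX` being circuits).
For the uniform circuit family of Regev's Lemma 3.14 (J. ACM 56 (2009), art. 34; arXiv:2401.03703 p. 20,
run as in the proof of Lemma 3.3 p. 15 with the `CVP` procedure in the oracle slot) the stage must be ONE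
gate list whose matrix is that product, the slot holding a subroutine circuit `T` transported onto its zone
`E` of the work register:

* `stageCirc hΛ hF E T` — `C_Y`, `C_S`, `T` along `E`, `C_X`, `T` along `E` (time order);
* **`toMatrix_stageCirc`** — its matrix is `stageMat hΛ hF (placeGate E (T.toMatrix 0))`
  (`toMatrix_append`, `toMatrix_mapWires`);
* `isOracleFree_stageCirc` (for oracle-free `T`), `size_stageCirc`.

Everything is proved; the definition has a body; no named fact is introduced.

## References

* O. Regev, *On lattices, learning with errors, random linear codes, and cryptography*, J. ACM 56
  (2009), art. 34; author's version arXiv:2401.03703: Lemma 3.14 (proof, p. 20), Lemma 3.3 (proof,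
  p. 15) [Regev2009].
* M. A. Nielsen, I. L. Chuang, *Quantum Computation and Quantum Information*, CUP 2010, §4.2
  (composition of circuits = product of unitaries), §3.2.5 [NielsenChuang2010].
-/

noncomputable section

namespace Literature.Computability.Cryptography

namespace Regev2009

namespace SamplerClassical

open Literature.Computability.QuantumComplexity _root_.Matrix

variable {W n : ℕ} {Λ : Layout W n} (hΛ : Λ.OK) (hF : Fits Λ)

/-- **The classical stage as one circuit**: the branch block, the residue block, the subroutine `T`
transported onto `E`, the erasing block, the subroutine again. [cite: Regev2009, Lemma 3.14 (proof), Lemma 3.3 (proof)] -/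
def stageCirc {M : ℕ} (E : Fin M ↪ Fin W) (T : QCircuit cliffordT M) : QCircuit cliffordT W :=
  ((((circY hΛ hF).append (circS hΛ hF)).append (mapWires E T)).append (circX hΛ hF)).append (mapWires E T)

/-- **The matrix of the stage circuit is the stage matrix with the placed subroutine in the oracle slot.**
[cite: NielsenChuang2010, §4.2] -/
theorem toMatrix_stageCirc {M : ℕ} (E : Fin M ↪ Fin W) (T : QCircuit cliffordT M) :
    (stageCirc hΛ hF E T).toMatrix 0 = stageMat hΛ hF (placeGate E (T.toMatrix 0)) := by
  simp only [stageCirc, QCircuit.toMatrix_append, toMatrix_mapWires, stageMat, Matrix.mul_assoc]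

/-- Running the stage circuit is applying the stage matrix. [cite: NielsenChuang2010, §4.2] -/
theorem runOn_stageCirc {M : ℕ} (E : Fin M ↪ Fin W) (T : QCircuit cliffordT M) (ψ : QReg W → ℂ) :
    (stageCirc hΛ hF E T).runOn 0 ψ = stageMat hΛ hF (placeGate E (T.toMatrix 0)) *ᵥ ψ := by
  rw [QCircuit.runOn, toMatrix_stageCirc]

/-- The stage circuit is oracle-free when the subroutine is. [folklore] -/
theorem isOracleFree_stageCirc {M : ℕ} (E : Fin M ↪ Fin W) {T : QCircuit cliffordT M} (hT : T.IsOracleFree) :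
    (stageCirc hΛ hF E T).IsOracleFree := by
  have hmap : (mapWires E T).IsOracleFree := by
    intro g hg
    simp only [mapWires, List.mem_map] at hg
    obtain ⟨g', hg', rfl⟩ := hg
    have := hT g' hg'
    cases g' with
    | gate o e => trivial
    | oracle k e => exact absurd this (by simp [QGate.IsOracleFree])
  intro g hg
  simp only [stageCirc, QCircuit.append, List.mem_append] at hg
  rcases hg with (((hg | hg) | hg) | hg) | hg
  · exact CleanXor.circuit_isOracleFree _ g hg
  · exact CleanXor.circuit_isOracleFree _ g hg
  · exact hmap g hg
  · exact CleanXor.circuit_isOracleFree _ g hg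
  · exact hmap g hg

/-- The size of the stage circuit. [folklore] -/
theorem size_stageCirc {M : ℕ} (E : Fin M ↪ Fin W) (T : QCircuit cliffordT M) :
    (stageCirc hΛ hF E T).size = (circY hΛ hF).size + (circS hΛ hF).size + T.size + (circX hΛ hF).size + T.size := by
  simp only [stageCirc, QCircuit.size_append, size_mapWires]

end SamplerClassical

end Regev2009

end Literature.Computability.Cryptography

end
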